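import Literature.NumberTheory.Rogawski1990.LocalTransferExplicitNonsplit        -- ★ the letter currency (`IsLocalGRegular`, `IsLocalStablyConjH`, `stableOrbitalIntegralRel`, `finExplicitCollection`, `IsLocSmooth`, …)
import Literature.NumberTheory.Rogawski1990.FinExplicitTransferFactorCentral      -- ★ the CENTRAL-CHARACTER RULE `finExplicitDelta_central_mul`, `conjLocal_central_mul_self`, `isLocalNormPair_central_mul`
import Literature.NumberTheory.Rogawski1990.LocalTransferLinear                    -- ★ `isRegularElt_of_isLocalNormPair`
import Literature.NumberTheory.Automorphic.LocalEndoscopicOrbitClosed             -- ★ `isGRegular_of_isStablyConjH`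
import Literature.NumberTheory.Automorphic.OrbitalIntegralCentralTranslate        -- A-p12 (g19) FILE A: `IsCanonical.classOrbitalIntegral_mk_central_mul_eq`, `….stableOrbitalIntegralRel_central_mul_eq`, class bijection `c ↦ ⟦z·out c⟧`
import HarnessLib

/-!
# F0P3a «N6nsGerm» — the identity core `stub_N6nsS3` (local `Δ‴_v`-transfer at a CENTRAL `εH = (a·1₂, a)`) REDUCED TO THE IDENTITY `εH = 1`

Crux H413 = stmt-HodgeConjecture-24833, line «N6nsGerm» (`Cruxes/H413/Lines/F0_P3a_N6nsGerm.lean` ED. 1.9, stub `stub_N6nsS3` :516, the (S3) «IDENTITY CORE»,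
booked as a PRINT row [LanglandsShelstad1990Descent (2.1.2) «local Δ-transfer at the identity»; LanglandsShelstad1989 II Thm. (end of §2); Rogawski1990 Prop. 8.3.1]
by LEAD F0P3a-plan (g9) WORD T8-160 on A-p13 (g31)'s cost census 37220e2f); A-p13's §6 (1) «C0 — central translation on the orbital side» (the one cheap
in-house piece of S3, «architects' call» to shrink the registered text to the `a = 1` case); seat A-p12 (g19), architect lineage of «N6nsGerm».

WHAT THIS FILE PROVES (no new mathematics — Rogawski's central-character rule on BOTH sides of (4.3.1)).  The registered stub quantifies over every CENTRAL
`εH = (a·1₂, a) ∈ H_v` (`a ∈ L_w¹`); print states local transfer AT THE IDENTITY.  The two are equivalent: with `z := a·1₃ ∈ G′_v` (central, ★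
`scalar_mem_unitaryGroupOfForm`), the factor obeys `Δ‴_v(εH γH, z γ) = μ_v(a) Δ‴_v(γH, γ)` (★ `finExplicitDelta_central_mul`), the canonical orbital integrals obey
`Φ(⟦z γ⟧, φ) = Φ(⟦γ⟧, φ(z·))` and `Φ^st(εH γH, φH) = Φ^st(γH, φH(εH·))` (★ A-p12 FILE A), `G`-regularity and stable conjugacy are invariant under central
translation (§2), and `y ↦ εH·y` is a homeomorphism of `H_v` carrying `𝓝 1` to `𝓝 εH`.  Hence an identity-local transfer `φH′` for `φ′ := φ(z·)` on `V′ ∈ 𝓝 1`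
yields the transfer `φH := μ_v(a) · φH′(εH⁻¹·)` for `φ` on `εH·V′ ∈ 𝓝 εH` — **`stub_N6nsS3_of_identity : (S3 at εH = 1) → (S3 as registered)`**, the hypothesis
being the stub's text with the binders `(εH) (a)` and their two hypothesis lines dropped and `𝓝 εH ↦ 𝓝 1` (§3).  At the next «N6nsGerm» edition the architects may
re-register `stub_N6nsS3 := stub_N6nsS3_of_identity stub_N6nsS3id` with the SMALLER stub `stub_N6nsS3id` = exactly [LS90 (2.1.2)] — count-neutral; a fidelity gain.

* §1 (generic, commutative ring) `charpoly_units_smul_comp_C_mul_X` (`χ_{uM}(uX) = u^n χ_M(X)`), `separable_charpoly_units_smul_iff` — regularity is invariant under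
  central unit scalars.
* §2 (the local carriers) `isLocalGRegular_central_mul_iff`, `isLocalStablyConjH_central_mul_iff`, `isLocalStablyConjH_conj_right_iff`, `coe_endoEmbLocal_of_central`.
* §3 **`stub_N6nsS3_of_identity`**.
HONEST LABEL: HC_CM is proved only modulo the printed citations (2 remaining named inputs hLiu418 24832, h413 24833) until rung 0 closes; S3 itself stays a PRINT row
(Shalika-germ territory, XL) — this file only normalises its statement to the printed one.

## References
* [Rogawski1990] J. D. Rogawski, *Automorphic Representations of Unitary Groups in Three Variables*, Ann. of Math. Stud. 123 (1990): §4.3 (4.3.1) p. 43; §4.9 p. 55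
  («`Δ_{G∕H}(zγ) = μ(z)Δ_{G∕H}(γ)`»); §8.3 Prop. 8.3.1 p. 116.
* [LanglandsShelstad1990Descent] R. P. Langlands, D. Shelstad, *Descent for transfer factors*, The Grothendieck Festschrift II (1990): §2.1 (2.1.2), Lemma 2.2.A.
* [BourbakiAlgebraI1989] N. Bourbaki, *Algebra I* (1989): Ch. I §5 no. 4; Ch. III §8 (characteristic polynomial).
-/

set_option linter.dupNamespace false -- the mandated namespace repeats the single-problem summit segment
set_option autoImplicit false

noncomputable section

open NumberField IsDedekindDomain MeasureTheory Measure Topology Filter Polynomial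
open Literature.NumberTheory.Rogawski1990 Literature.NumberTheory.Automorphic Literature.NumberTheory.GaloisRepresentations
open Literature.AlgebraicGeometry.ShimuraVarieties (unitaryGroup hermForm)
open scoped Matrix MatrixGroups Classical

namespace Summit.HodgeConjecture.HodgeConjecture.Cruxes.H413.F0P3aN6nsS3OfIdentity

/-! ## §1 Regularity is invariant under central unit scalars (generic) -/

section Charpoly

variable {R : Type*} [CommRing R] {n : Type*} [Fintype n] [DecidableEq n]

/-- **`χ_{uM}(uX) = u^n · χ_M(X)`** for a unit scalar `u` (substitute `X ↦ uX` in `det(X − uM) = det(u(u⁻¹X − M))`). [cite: BourbakiAlgebraI1989, Ch. III §8 no. 11] -/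
theorem charpoly_units_smul_comp_C_mul_X (u : Rˣ) (M : Matrix n n R) :
    (((u : R) • M).charpoly).comp (C (u : R) * X) = C ((u : R) ^ Fintype.card n) * M.charpoly := by
  have h1 : (((u : R) • M).charpoly).comp (C (u : R) * X) =
      ((Polynomial.compRingHom (C (u : R) * X)).mapMatrix (Matrix.charmatrix ((u : R) • M))).det := by
    rw [Matrix.charpoly, ← RingHom.map_det]; rfl
  have h2 : (Polynomial.compRingHom (C (u : R) * X)).mapMatrix (Matrix.charmatrix ((u : R) • M)) = C (u : R) • Matrix.charmatrix M := by
    ext i j : 2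
    by_cases hij : i = j
    · subst hij
      simp [Matrix.charmatrix_apply_eq, mul_sub]
    · simp [Matrix.charmatrix_apply_ne _ _ _ hij, smul_eq_mul]
  rw [h1, h2, Matrix.det_smul, Matrix.charpoly, ← C_pow]

/-- `p` separable ⇒ `p(uX)` separable for a unit `u` (the derivative of `p(uX)` is `u · p′(uX)`). [cite: BourbakiAlgebraI1989, Ch. III §8 no. 11] -/
theorem separable_comp_C_units_mul_X {p : R[X]} (hp : p.Separable) (u : Rˣ) : (p.comp (C (u : R) * X)).Separable := by
  have hcop : IsCoprime (p.comp (C (u : R) * X)) ((derivative p).comp (C (u : R) * X)) := by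
    have h0 : IsCoprime p (derivative p) := hp
    exact h0.map (Polynomial.compRingHom (C (u : R) * X))
  have hder : derivative (p.comp (C (u : R) * X)) = (derivative p).comp (C (u : R) * X) * C (u : R) := by
    rw [Polynomial.derivative_comp, Polynomial.derivative_C_mul_X, mul_comm]
  have hunit : IsCoprime (p.comp (C (u : R) * X)) (C (u : R)) :=
    ⟨0, C ((u⁻¹ : Rˣ) : R), by rw [zero_mul, zero_add, ← C_mul, Units.inv_mul, C_1]⟩
  rw [Polynomial.Separable, hder]
  exact hcop.mul_right hunit

/-- **`χ_{uM}` separable ↔ `χ_M` separable** for a unit `u`: regularity of a matrix is invariant under central unit scalars. [cite: BourbakiAlgebraI1989, Ch. III §8 no. 11] -/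
theorem separable_charpoly_units_smul_iff (u : Rˣ) (M : Matrix n n R) : (((u : R) • M).charpoly).Separable ↔ (M.charpoly).Separable := by
  have key : ∀ (w : Rˣ) (N : Matrix n n R), (((w : R) • N).charpoly).Separable → (N.charpoly).Separable := fun w N h => by
    have h' := separable_comp_C_units_mul_X h w
    rw [charpoly_units_smul_comp_C_mul_X] at h'
    exact h'.of_mul_right
  refine ⟨key u M, fun h => key u⁻¹ ((u : R) • M) ?_⟩
  rwa [smul_smul, Units.inv_mul, one_smul]

end Charpoly

/-! ## §2 Central elements of `H_v` and `G′_v`: `G`-regularity, stable conjugacy, the matrix of `ι_v(εH)` -/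

section Central

variable (L : Type) [Field L] [NumberField L] [IsCMField L] (v : HeightOneSpectrum (𝓞 ↥(maximalRealSubfield L)))

/-- **`ι_v(εH)` is the scalar `ζ·1₃`** when `εH = (ζ·1₂, ζ·1₁)` (★ `coe_endoEmbLocal`, ★ `coe_endoGL_eq`). [cite: Rogawski1990, §4.9 p. 55] -/
theorem coe_endoEmbLocal_of_central (zH : (((UnitaryGroup.cmDatum L 2 (Matrix.of fun i j : Fin 2 => if i.val + j.val + 1 = 2 then (1 : L) else 0)).Local v × (UnitaryGroup.cmDatum L 1 (Matrix.of fun i j : Fin 1 => if i.val + j.val + 1 = 1 then (1 : L) else 0)).Local v))) (ζ : (UnitaryGroup.LocalRing L v))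
    (hz1 : (zH.1.val.val : Matrix (Fin 2) (Fin 2) (UnitaryGroup.LocalRing L v)) = ζ • (1 : Matrix (Fin 2) (Fin 2) (UnitaryGroup.LocalRing L v)))
    (hz2 : (zH.2.val.val : Matrix (Fin 1) (Fin 1) (UnitaryGroup.LocalRing L v)) = ζ • (1 : Matrix (Fin 1) (Fin 1) (UnitaryGroup.LocalRing L v))) :
    ((endoEmbLocal L v zH).val.val : Matrix (Fin 3) (Fin 3) (UnitaryGroup.LocalRing L v)) = ζ • (1 : Matrix (Fin 3) (Fin 3) (UnitaryGroup.LocalRing L v)) := by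
  rw [coe_endoEmbLocal, coe_endoGL_eq, hz1, hz2]
  refine Matrix.ext fun i j => ?_
  fin_cases i <;> fin_cases j <;> simp [Matrix.smul_apply]

/-- **`G`-REGULARITY IS INVARIANT UNDER CENTRAL TRANSLATION IN `H_v`**: for `εH = (ζ·1₂, ζ·1₁)` with `ζ` a unit, `εH γH` is `G`-regular iff `γH` is
(`ι_v(εH γH) = ζ · ι_v(γH)`, §1). [cite: Rogawski1990, §4.3 p. 42; §4.9 p. 55] -/
theorem isLocalGRegular_central_mul_iff (zH : (((UnitaryGroup.cmDatum L 2 (Matrix.of fun i j : Fin 2 => if i.val + j.val + 1 = 2 then (1 : L) else 0)).Local v × (UnitaryGroup.cmDatum L 1 (Matrix.of fun i j : Fin 1 => if i.val + j.val + 1 = 1 then (1 : L) else 0)).Local v))) (ζ : (UnitaryGroup.LocalRing L v)) (hζ : IsUnit ζ)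
    (hz1 : (zH.1.val.val : Matrix (Fin 2) (Fin 2) (UnitaryGroup.LocalRing L v)) = ζ • (1 : Matrix (Fin 2) (Fin 2) (UnitaryGroup.LocalRing L v)))
    (hz2 : (zH.2.val.val : Matrix (Fin 1) (Fin 1) (UnitaryGroup.LocalRing L v)) = ζ • (1 : Matrix (Fin 1) (Fin 1) (UnitaryGroup.LocalRing L v))) (γH : (((UnitaryGroup.cmDatum L 2 (Matrix.of fun i j : Fin 2 => if i.val + j.val + 1 = 2 then (1 : L) else 0)).Local v × (UnitaryGroup.cmDatum L 1 (Matrix.of fun i j : Fin 1 => if i.val + j.val + 1 = 1 then (1 : L) else 0)).Local v))) :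
    IsLocalGRegular L v (zH * γH) ↔ IsLocalGRegular L v γH := by
  have hmul : ((endoEmbLocal L v (zH * γH)).val.val : Matrix (Fin 3) (Fin 3) (UnitaryGroup.LocalRing L v)) = (hζ.unit : (UnitaryGroup.LocalRing L v)) • ((endoEmbLocal L v γH).val.val : Matrix (Fin 3) (Fin 3) (UnitaryGroup.LocalRing L v)) := by
    rw [map_mul]
    show ((endoEmbLocal L v zH).val.val : Matrix (Fin 3) (Fin 3) (UnitaryGroup.LocalRing L v)) * (endoEmbLocal L v γH).val.val = _
    rw [coe_endoEmbLocal_of_central L v zH ζ hz1 hz2, Matrix.smul_mul, Matrix.one_mul, IsUnit.unit_spec]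
  show IsRegularElt ((endoEmbLocal L v (zH * γH)).val : GL (Fin 3) (UnitaryGroup.LocalRing L v)) ↔ IsRegularElt ((endoEmbLocal L v γH).val : GL (Fin 3) (UnitaryGroup.LocalRing L v))
  rw [isRegularElt_iff, isRegularElt_iff, hmul, separable_charpoly_units_smul_iff]

/-- **Stable conjugacy in `H_v` is invariant under central translation**: `εH a ∼_st εH b ↔ a ∼_st b` for `εH = (ζ·1₂, ζ·1₁)` (componentwise ★ `IsStablyConj` =
conjugacy in the ambient `GL`, where `ζ·1` is central). [cite: Rogawski1990, §3.1 p. 19; §4.9 p. 55] -/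
theorem isLocalStablyConjH_central_mul_iff (zH : (((UnitaryGroup.cmDatum L 2 (Matrix.of fun i j : Fin 2 => if i.val + j.val + 1 = 2 then (1 : L) else 0)).Local v × (UnitaryGroup.cmDatum L 1 (Matrix.of fun i j : Fin 1 => if i.val + j.val + 1 = 1 then (1 : L) else 0)).Local v))) (ζ : (UnitaryGroup.LocalRing L v))
    (hz1 : (zH.1.val.val : Matrix (Fin 2) (Fin 2) (UnitaryGroup.LocalRing L v)) = ζ • (1 : Matrix (Fin 2) (Fin 2) (UnitaryGroup.LocalRing L v)))
    (hz2 : (zH.2.val.val : Matrix (Fin 1) (Fin 1) (UnitaryGroup.LocalRing L v)) = ζ • (1 : Matrix (Fin 1) (Fin 1) (UnitaryGroup.LocalRing L v))) (a b : (((UnitaryGroup.cmDatum L 2 (Matrix.of fun i j : Fin 2 => if i.val + j.val + 1 = 2 then (1 : L) else 0)).Local v × (UnitaryGroup.cmDatum L 1 (Matrix.of fun i j : Fin 1 => if i.val + j.val + 1 = 1 then (1 : L) else 0)).Local v))) :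
    IsLocalStablyConjH L v (zH * a) (zH * b) ↔ IsLocalStablyConjH L v a b := by
  have hc1 : (zH.1.val : GL (Fin 2) (UnitaryGroup.LocalRing L v)) ∈ Subgroup.center (GL (Fin 2) (UnitaryGroup.LocalRing L v)) := by
    rw [Subgroup.mem_center_iff]
    intro g
    apply Units.ext
    rw [Units.val_mul, Units.val_mul, hz1, Matrix.mul_smul, Matrix.smul_mul, Matrix.mul_one, Matrix.one_mul]
  have hc2 : (zH.2.val : GL (Fin 1) (UnitaryGroup.LocalRing L v)) ∈ Subgroup.center (GL (Fin 1) (UnitaryGroup.LocalRing L v)) := by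
    rw [Subgroup.mem_center_iff]
    intro g
    apply Units.ext
    rw [Units.val_mul, Units.val_mul, hz2, Matrix.mul_smul, Matrix.smul_mul, Matrix.mul_one, Matrix.one_mul]
  show IsConj ((zH * a).1.val : GL (Fin 2) (UnitaryGroup.LocalRing L v)) ((zH * b).1.val) ∧ IsConj ((zH * a).2.val : GL (Fin 1) (UnitaryGroup.LocalRing L v)) ((zH * b).2.val) ↔
    IsConj (a.1.val : GL (Fin 2) (UnitaryGroup.LocalRing L v)) (b.1.val) ∧ IsConj (a.2.val : GL (Fin 1) (UnitaryGroup.LocalRing L v)) (b.2.val)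
  exact Iff.and (isConj_central_mul_iff hc1 _ _) (isConj_central_mul_iff hc2 _ _)

omit [IsCMField L] in
/-- Stable conjugacy in `H_v` is a class function in its second argument. [cite: Rogawski1990, §3.1 p. 19] -/
theorem isLocalStablyConjH_conj_right_iff [IsCMField L] (a b x : (((UnitaryGroup.cmDatum L 2 (Matrix.of fun i j : Fin 2 => if i.val + j.val + 1 = 2 then (1 : L) else 0)).Local v × (UnitaryGroup.cmDatum L 1 (Matrix.of fun i j : Fin 1 => if i.val + j.val + 1 = 1 then (1 : L) else 0)).Local v))) :
    IsLocalStablyConjH L v a (x * b * x⁻¹) ↔ IsLocalStablyConjH L v a b := by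
  have h1 : IsLocalStablyConjH L v b (x * b * x⁻¹) := isStablyConjH_of_isConj (isConj_iff.2 ⟨x, rfl⟩)
  exact ⟨fun h => h.trans h1.symm, fun h => h.trans h1⟩

end Central

/-! ## §2b Linearity of the (stable) orbital integrals in the test function (scalars) -/

section Linearity

variable {G : Type*} [Group G] [∀ γ : G, MeasurableSpace (G ⧸ Subgroup.centralizer ({γ} : Set G))]

/-- `Φ(c, t·f) = t · Φ(c, f)` (★ `orbitalIntegral_smul`). [cite: Rogawski1990, §4.1 (4.1.1) p. 39] -/
theorem classOrbitalIntegral_const_mul (m : OrbitalMeasureFamily G) (t : ℂ) (f : G → ℂ) (c : ConjClasses G) :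
    classOrbitalIntegral m (fun x => t * f x) c = t * classOrbitalIntegral m f c := by
  rw [classOrbitalIntegral_eq, classOrbitalIntegral_eq, show (fun x => t * f x) = t • f from rfl, orbitalIntegral_smul, smul_eq_mul]

/-- `Φ^st(γ, t·f) = t · Φ^st(γ, f)` (no finiteness needed: ★ `mul_finsum_mem`). [cite: Rogawski1990, §4.1 (4.1.1) p. 39] -/
theorem stableOrbitalIntegralRel_const_mul (st : G → G → Prop) (m : OrbitalMeasureFamily G) (t : ℂ) (f : G → ℂ) (γ : G) :
    stableOrbitalIntegralRel st m (fun x => t * f x) γ = t * stableOrbitalIntegralRel st m f γ := by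
  rw [stableOrbitalIntegralRel_def, stableOrbitalIntegralRel_def, mul_finsum_mem]
  exact finsum_congr fun c => finsum_congr fun _ => classOrbitalIntegral_const_mul m t f c

end Linearity

/-! ## §3 The reduction: `stub_N6nsS3` ⟸ S3 at the identity -/

section Reduction

set_option maxHeartbeats 400000 in
/-- **THE IDENTITY CORE `stub_N6nsS3` FOLLOWS FROM ITS CASE `εH = 1`.**  Hypothesis = the registered text of `stub_N6nsS3` («N6nsGerm» ED. 1.9 :516) with the binders
`(εH) (a)`, the two lines `εH.1 = a•1 →`, `(εH.2) 0 0 = a →` DROPPED and `𝓝 εH ↦ 𝓝 1` — i.e. [LS90 (2.1.2)] «`(G′_v, H_v)` admits local `Δ‴_v`-transfer AT THE IDENTITY» for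
the canonical families; conclusion = the registered text VERBATIM.  Proof: given a central `εH = (a·1₂, a)` put `z := a·1₃ ∈ G′_v`; apply the hypothesis to
`φ′ := φ(z·)` (test, `IsLocSmooth`), getting `V′ ∈ 𝓝 1` and `φH′`; answer with `V := εH·V′ ∈ 𝓝 εH` and `φH := μ_v(a) · φH′(εH⁻¹·)`: for `γH = εH γH′ ∈ V` `G`-regular,
`Φ^st(εH γH′, φH) = μ_v(a) Φ^st(γH′, φH′)` (★ FILE A on `H_v`) and `Σ_c Δ‴(εH γH′, c) Φ(c, φ) = Σ_{c′} Δ‴(εH γH′, z c′) Φ(⟦z·out c′⟧, φ) = μ_v(a) Σ_{c′} Δ‴(γH′, c′) Φ(c′, φ′)`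
(class bijection `c′ ↦ ⟦z·out c′⟧`, ★ `finExplicitDelta_central_mul`, ★ FILE A on `G′_v` at the norm-pair classes — the others carry `Δ‴ = 0`).
[cite: Rogawski1990, §4.3 (4.3.1) p. 43; §4.9 p. 55] [cite: LanglandsShelstad1990Descent, §2.1 (2.1.2)] -/
theorem stub_N6nsS3_of_identity
    (hId :
        ∀ (L : Type) [Field L] [NumberField L] [IsCMField L] (H' : Matrix (Fin 3) (Fin 3) L) (μ : HeckeCharacter L)
          [∀ v : HeightOneSpectrum (𝓞 ↥(maximalRealSubfield L)),
            MeasurableSpace ((UnitaryGroup.cmDatum L 2 (Matrix.of fun i j : Fin 2 => if i.val + j.val + 1 = 2 then (1 : L) else 0)).Local v ×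
              (UnitaryGroup.cmDatum L 1 (Matrix.of fun i j : Fin 1 => if i.val + j.val + 1 = 1 then (1 : L) else 0)).Local v)]
          [∀ v : HeightOneSpectrum (𝓞 ↥(maximalRealSubfield L)),
            BorelSpace ((UnitaryGroup.cmDatum L 2 (Matrix.of fun i j : Fin 2 => if i.val + j.val + 1 = 2 then (1 : L) else 0)).Local v ×
              (UnitaryGroup.cmDatum L 1 (Matrix.of fun i j : Fin 1 => if i.val + j.val + 1 = 1 then (1 : L) else 0)).Local v)]
          [∀ v : HeightOneSpectrum (𝓞 ↥(maximalRealSubfield L)), MeasurableSpace ((UnitaryGroup.cmDatum L 3 H').Local v)]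
          [∀ v : HeightOneSpectrum (𝓞 ↥(maximalRealSubfield L)), BorelSpace ((UnitaryGroup.cmDatum L 3 H').Local v)]
          (νH : ∀ v : HeightOneSpectrum (𝓞 ↥(maximalRealSubfield L)),
            Measure ((UnitaryGroup.cmDatum L 2 (Matrix.of fun i j : Fin 2 => if i.val + j.val + 1 = 2 then (1 : L) else 0)).Local v ×
              (UnitaryGroup.cmDatum L 1 (Matrix.of fun i j : Fin 1 => if i.val + j.val + 1 = 1 then (1 : L) else 0)).Local v))
          (νG : ∀ v : HeightOneSpectrum (𝓞 ↥(maximalRealSubfield L)), Measure ((UnitaryGroup.cmDatum L 3 H').Local v))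
          [∀ v, (νH v).IsHaarMeasure] [∀ v, (νH v).IsMulRightInvariant] [∀ v, (νG v).IsHaarMeasure] [∀ v, (νG v).IsMulRightInvariant],
          μ.IsUnitary →
          (∀ x : ideleGroup ↥(maximalRealSubfield L), μ (AdeleRing.ideleBaseChange (↥(maximalRealSubfield L)) L x) = quadraticHeckeCharCM L x) →
          (H'.map (cmConjRingHom L)).transpose = H' →
          (∀ x : Fin 3 → L, hermForm (cmConjRingHom L) H' x x = 0 → x = 0) →
          ∀ (v : HeightOneSpectrum (𝓞 ↥(maximalRealSubfield L))), Subsingleton (UnitaryGroup.PlacesOver L v) →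
          ∀ [_iH : ∀ a : ((UnitaryGroup.cmDatum L 2 (Matrix.of fun i j : Fin 2 => if i.val + j.val + 1 = 2 then (1 : L) else 0)).Local v × (UnitaryGroup.cmDatum L 1 (Matrix.of fun i j : Fin 1 => if i.val + j.val + 1 = 1 then (1 : L) else 0)).Local v),
              MeasurableSpace (((UnitaryGroup.cmDatum L 2 (Matrix.of fun i j : Fin 2 => if i.val + j.val + 1 = 2 then (1 : L) else 0)).Local v × (UnitaryGroup.cmDatum L 1 (Matrix.of fun i j : Fin 1 => if i.val + j.val + 1 = 1 then (1 : L) else 0)).Local v) ⧸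
                Subgroup.centralizer ({a} : Set ((UnitaryGroup.cmDatum L 2 (Matrix.of fun i j : Fin 2 => if i.val + j.val + 1 = 2 then (1 : L) else 0)).Local v × (UnitaryGroup.cmDatum L 1 (Matrix.of fun i j : Fin 1 => if i.val + j.val + 1 = 1 then (1 : L) else 0)).Local v)))]
            [_bH : ∀ a : ((UnitaryGroup.cmDatum L 2 (Matrix.of fun i j : Fin 2 => if i.val + j.val + 1 = 2 then (1 : L) else 0)).Local v × (UnitaryGroup.cmDatum L 1 (Matrix.of fun i j : Fin 1 => if i.val + j.val + 1 = 1 then (1 : L) else 0)).Local v),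
              BorelSpace (((UnitaryGroup.cmDatum L 2 (Matrix.of fun i j : Fin 2 => if i.val + j.val + 1 = 2 then (1 : L) else 0)).Local v × (UnitaryGroup.cmDatum L 1 (Matrix.of fun i j : Fin 1 => if i.val + j.val + 1 = 1 then (1 : L) else 0)).Local v) ⧸
                Subgroup.centralizer ({a} : Set ((UnitaryGroup.cmDatum L 2 (Matrix.of fun i j : Fin 2 => if i.val + j.val + 1 = 2 then (1 : L) else 0)).Local v × (UnitaryGroup.cmDatum L 1 (Matrix.of fun i j : Fin 1 => if i.val + j.val + 1 = 1 then (1 : L) else 0)).Local v)))]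
            [_iG : ∀ γ : ((UnitaryGroup.cmDatum L 3 H').Local v), MeasurableSpace (((UnitaryGroup.cmDatum L 3 H').Local v) ⧸ Subgroup.centralizer ({γ} : Set ((UnitaryGroup.cmDatum L 3 H').Local v)))]
            [_bG : ∀ γ : ((UnitaryGroup.cmDatum L 3 H').Local v), BorelSpace (((UnitaryGroup.cmDatum L 3 H').Local v) ⧸ Subgroup.centralizer ({γ} : Set ((UnitaryGroup.cmDatum L 3 H').Local v)))]
            (mH : OrbitalMeasureFamily ((UnitaryGroup.cmDatum L 2 (Matrix.of fun i j : Fin 2 => if i.val + j.val + 1 = 2 then (1 : L) else 0)).Local v × (UnitaryGroup.cmDatum L 1 (Matrix.of fun i j : Fin 1 => if i.val + j.val + 1 = 1 then (1 : L) else 0)).Local v))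
            (mG : OrbitalMeasureFamily ((UnitaryGroup.cmDatum L 3 H').Local v)),
          mH.IsCanonical (IsLocalGRegular L v) (νH v) → mG.IsCanonical (fun γ => IsRegularElt (γ.val : GL (Fin 3) (UnitaryGroup.LocalRing L v))) (νG v) →
          ∀ (φ : ((UnitaryGroup.cmDatum L 3 H').Local v) → ℂ), IsLocSmooth φ →
            ∃ V ∈ 𝓝 (1 : ((UnitaryGroup.cmDatum L 2 (Matrix.of fun i j : Fin 2 => if i.val + j.val + 1 = 2 then (1 : L) else 0)).Local v × (UnitaryGroup.cmDatum L 1 (Matrix.of fun i j : Fin 1 => if i.val + j.val + 1 = 1 then (1 : L) else 0)).Local v)), ∃ φH : ((UnitaryGroup.cmDatum L 2 (Matrix.of fun i j : Fin 2 => if i.val + j.val + 1 = 2 then (1 : L) else 0)).Local v × (UnitaryGroup.cmDatum L 1 (Matrix.of fun i j : Fin 1 => if i.val + j.val + 1 = 1 then (1 : L) else 0)).Local v) → ℂ, IsLocSmooth φH ∧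
              ∀ γH ∈ V, IsLocalGRegular L v γH →
                stableOrbitalIntegralRel (IsLocalStablyConjH L v) mH φH γH =
                  ∑ᶠ c : ConjClasses ((UnitaryGroup.cmDatum L 3 H').Local v), ((finExplicitCollection L H' μ (finExplicitDelta_conj_left_all L H' μ) (finExplicitDelta_conj_right_all L H' μ)) v).Δ γH (Quotient.out c) * classOrbitalIntegral mG φ c) :
    ∀ (L : Type) [Field L] [NumberField L] [IsCMField L] (H' : Matrix (Fin 3) (Fin 3) L) (μ : HeckeCharacter L)
      [∀ v : HeightOneSpectrum (𝓞 ↥(maximalRealSubfield L)),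
        MeasurableSpace ((UnitaryGroup.cmDatum L 2 (Matrix.of fun i j : Fin 2 => if i.val + j.val + 1 = 2 then (1 : L) else 0)).Local v ×
          (UnitaryGroup.cmDatum L 1 (Matrix.of fun i j : Fin 1 => if i.val + j.val + 1 = 1 then (1 : L) else 0)).Local v)]
      [∀ v : HeightOneSpectrum (𝓞 ↥(maximalRealSubfield L)),
        BorelSpace ((UnitaryGroup.cmDatum L 2 (Matrix.of fun i j : Fin 2 => if i.val + j.val + 1 = 2 then (1 : L) else 0)).Local v ×
          (UnitaryGroup.cmDatum L 1 (Matrix.of fun i j : Fin 1 => if i.val + j.val + 1 = 1 then (1 : L) else 0)).Local v)]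
      [∀ v : HeightOneSpectrum (𝓞 ↥(maximalRealSubfield L)), MeasurableSpace ((UnitaryGroup.cmDatum L 3 H').Local v)]
      [∀ v : HeightOneSpectrum (𝓞 ↥(maximalRealSubfield L)), BorelSpace ((UnitaryGroup.cmDatum L 3 H').Local v)]
      (νH : ∀ v : HeightOneSpectrum (𝓞 ↥(maximalRealSubfield L)),
        Measure ((UnitaryGroup.cmDatum L 2 (Matrix.of fun i j : Fin 2 => if i.val + j.val + 1 = 2 then (1 : L) else 0)).Local v ×
          (UnitaryGroup.cmDatum L 1 (Matrix.of fun i j : Fin 1 => if i.val + j.val + 1 = 1 then (1 : L) else 0)).Local v))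
      (νG : ∀ v : HeightOneSpectrum (𝓞 ↥(maximalRealSubfield L)), Measure ((UnitaryGroup.cmDatum L 3 H').Local v))
      [∀ v, (νH v).IsHaarMeasure] [∀ v, (νH v).IsMulRightInvariant] [∀ v, (νG v).IsHaarMeasure] [∀ v, (νG v).IsMulRightInvariant],
      μ.IsUnitary →
      (∀ x : ideleGroup ↥(maximalRealSubfield L), μ (AdeleRing.ideleBaseChange (↥(maximalRealSubfield L)) L x) = quadraticHeckeCharCM L x) →
      (H'.map (cmConjRingHom L)).transpose = H' →
      (∀ x : Fin 3 → L, hermForm (cmConjRingHom L) H' x x = 0 → x = 0) →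
      ∀ (v : HeightOneSpectrum (𝓞 ↥(maximalRealSubfield L))), Subsingleton (UnitaryGroup.PlacesOver L v) →
      ∀ [_iH : ∀ a : ((UnitaryGroup.cmDatum L 2 (Matrix.of fun i j : Fin 2 => if i.val + j.val + 1 = 2 then (1 : L) else 0)).Local v × (UnitaryGroup.cmDatum L 1 (Matrix.of fun i j : Fin 1 => if i.val + j.val + 1 = 1 then (1 : L) else 0)).Local v),
          MeasurableSpace (((UnitaryGroup.cmDatum L 2 (Matrix.of fun i j : Fin 2 => if i.val + j.val + 1 = 2 then (1 : L) else 0)).Local v × (UnitaryGroup.cmDatum L 1 (Matrix.of fun i j : Fin 1 => if i.val + j.val + 1 = 1 then (1 : L) else 0)).Local v) ⧸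
            Subgroup.centralizer ({a} : Set ((UnitaryGroup.cmDatum L 2 (Matrix.of fun i j : Fin 2 => if i.val + j.val + 1 = 2 then (1 : L) else 0)).Local v × (UnitaryGroup.cmDatum L 1 (Matrix.of fun i j : Fin 1 => if i.val + j.val + 1 = 1 then (1 : L) else 0)).Local v)))]
        [_bH : ∀ a : ((UnitaryGroup.cmDatum L 2 (Matrix.of fun i j : Fin 2 => if i.val + j.val + 1 = 2 then (1 : L) else 0)).Local v × (UnitaryGroup.cmDatum L 1 (Matrix.of fun i j : Fin 1 => if i.val + j.val + 1 = 1 then (1 : L) else 0)).Local v),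
          BorelSpace (((UnitaryGroup.cmDatum L 2 (Matrix.of fun i j : Fin 2 => if i.val + j.val + 1 = 2 then (1 : L) else 0)).Local v × (UnitaryGroup.cmDatum L 1 (Matrix.of fun i j : Fin 1 => if i.val + j.val + 1 = 1 then (1 : L) else 0)).Local v) ⧸
            Subgroup.centralizer ({a} : Set ((UnitaryGroup.cmDatum L 2 (Matrix.of fun i j : Fin 2 => if i.val + j.val + 1 = 2 then (1 : L) else 0)).Local v × (UnitaryGroup.cmDatum L 1 (Matrix.of fun i j : Fin 1 => if i.val + j.val + 1 = 1 then (1 : L) else 0)).Local v)))]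
        [_iG : ∀ γ : ((UnitaryGroup.cmDatum L 3 H').Local v), MeasurableSpace (((UnitaryGroup.cmDatum L 3 H').Local v) ⧸ Subgroup.centralizer ({γ} : Set ((UnitaryGroup.cmDatum L 3 H').Local v)))]
        [_bG : ∀ γ : ((UnitaryGroup.cmDatum L 3 H').Local v), BorelSpace (((UnitaryGroup.cmDatum L 3 H').Local v) ⧸ Subgroup.centralizer ({γ} : Set ((UnitaryGroup.cmDatum L 3 H').Local v)))]
        (mH : OrbitalMeasureFamily ((UnitaryGroup.cmDatum L 2 (Matrix.of fun i j : Fin 2 => if i.val + j.val + 1 = 2 then (1 : L) else 0)).Local v × (UnitaryGroup.cmDatum L 1 (Matrix.of fun i j : Fin 1 => if i.val + j.val + 1 = 1 then (1 : L) else 0)).Local v))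
        (mG : OrbitalMeasureFamily ((UnitaryGroup.cmDatum L 3 H').Local v)),
      mH.IsCanonical (IsLocalGRegular L v) (νH v) → mG.IsCanonical (fun γ => IsRegularElt (γ.val : GL (Fin 3) (UnitaryGroup.LocalRing L v))) (νG v) →
      ∀ (φ : ((UnitaryGroup.cmDatum L 3 H').Local v) → ℂ), IsLocSmooth φ →
      ∀ (εH : ((UnitaryGroup.cmDatum L 2 (Matrix.of fun i j : Fin 2 => if i.val + j.val + 1 = 2 then (1 : L) else 0)).Local v × (UnitaryGroup.cmDatum L 1 (Matrix.of fun i j : Fin 1 => if i.val + j.val + 1 = 1 then (1 : L) else 0)).Local v)) (a : (UnitaryGroup.LocalRing L v)),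
        (εH.1.val.val : Matrix (Fin 2) (Fin 2) (UnitaryGroup.LocalRing L v)) = a • (1 : Matrix (Fin 2) (Fin 2) (UnitaryGroup.LocalRing L v)) →
        (εH.2.val.val : Matrix (Fin 1) (Fin 1) (UnitaryGroup.LocalRing L v)) 0 0 = a →
        ∃ V ∈ 𝓝 εH, ∃ φH : ((UnitaryGroup.cmDatum L 2 (Matrix.of fun i j : Fin 2 => if i.val + j.val + 1 = 2 then (1 : L) else 0)).Local v × (UnitaryGroup.cmDatum L 1 (Matrix.of fun i j : Fin 1 => if i.val + j.val + 1 = 1 then (1 : L) else 0)).Local v) → ℂ, IsLocSmooth φH ∧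
          ∀ γH ∈ V, IsLocalGRegular L v γH →
            stableOrbitalIntegralRel (IsLocalStablyConjH L v) mH φH γH =
              ∑ᶠ c : ConjClasses ((UnitaryGroup.cmDatum L 3 H').Local v), ((finExplicitCollection L H' μ (finExplicitDelta_conj_left_all L H' μ) (finExplicitDelta_conj_right_all L H' μ)) v).Δ γH (Quotient.out c) * classOrbitalIntegral mG φ c := by
  intro L _ _ _ H' μ _i1 _i2 _i3 _i4 νH νG _h1 _h2 _h3 _h4 hμu hμω hH hHan v hv _iH _bH _iG _bG mH mG hcanH hcanG φ hφ εH a h1 h2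
  -- `εH.2 = a·1₁`, `σ(a) a = 1`, `a` a unit
  have h2' : (εH.2.val.val : Matrix (Fin 1) (Fin 1) (UnitaryGroup.LocalRing L v)) = a • (1 : Matrix (Fin 1) (Fin 1) (UnitaryGroup.LocalRing L v)) := by
    refine Matrix.ext fun i j => ?_
    fin_cases i; fin_cases j
    rw [Matrix.smul_apply, Matrix.one_apply_eq, smul_eq_mul, mul_one]
    exact h2
  have haa : UnitaryGroup.conjLocal L (IsCMField.complexConj L) v a * a = 1 := conjLocal_central_mul_self L v εH a h2'
  have ha : IsUnit a := IsUnit.of_mul_eq_one_right _ haa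
  have hau : UnitaryGroup.conjLocal L (IsCMField.complexConj L) v (ha.unit : UnitaryGroup.LocalRing L v) * ha.unit = 1 := by
    rw [IsUnit.unit_spec]; exact haa
  -- the central element `z = a·1₃ ∈ G′_v`
  obtain ⟨z, hz⟩ : ∃ z : (UnitaryGroup.cmDatum L 3 H').Local v,
      (z.val.val : Matrix (Fin 3) (Fin 3) (UnitaryGroup.LocalRing L v)) = a • (1 : Matrix (Fin 3) (Fin 3) (UnitaryGroup.LocalRing L v)) := by
    refine ⟨Subtype.mk (Units.map ((Matrix.scalar (Fin 3) : UnitaryGroup.LocalRing L v →+* Matrix (Fin 3) (Fin 3) (UnitaryGroup.LocalRing L v)) :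
        UnitaryGroup.LocalRing L v →* Matrix (Fin 3) (Fin 3) (UnitaryGroup.LocalRing L v)) ha.unit)
      (scalar_mem_unitaryGroupOfForm (UnitaryGroup.conjLocal L (IsCMField.complexConj L) v)
        ((UnitaryGroup.adelicForm L 3 H').map (UnitaryGroup.adeleToLocal L v)) ha.unit hau), ?_⟩
    show ((Matrix.scalar (Fin 3) : UnitaryGroup.LocalRing L v →+* Matrix (Fin 3) (Fin 3) (UnitaryGroup.LocalRing L v)) (ha.unit : UnitaryGroup.LocalRing L v)) =
      a • (1 : Matrix (Fin 3) (Fin 3) (UnitaryGroup.LocalRing L v))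
    rw [Matrix.scalar_apply, IsUnit.unit_spec, Matrix.smul_one_eq_diagonal]
  -- `z` and `εH` are central
  have hzc : z ∈ Subgroup.center ((UnitaryGroup.cmDatum L 3 H').Local v) := by
    rw [Subgroup.mem_center_iff]
    intro g
    apply Subtype.ext
    apply Units.ext
    show (g.val.val : Matrix (Fin 3) (Fin 3) (UnitaryGroup.LocalRing L v)) * z.val.val = z.val.val * g.val.val
    rw [hz, Matrix.mul_smul, Matrix.smul_mul, Matrix.mul_one, Matrix.one_mul]
  have hεc : εH ∈ Subgroup.center ((UnitaryGroup.cmDatum L 2 (Matrix.of fun i j : Fin 2 => if i.val + j.val + 1 = 2 then (1 : L) else 0)).Local v × (UnitaryGroup.cmDatum L 1 (Matrix.of fun i j : Fin 1 => if i.val + j.val + 1 = 1 then (1 : L) else 0)).Local v) := by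
    rw [Subgroup.mem_center_iff]
    intro g
    refine Prod.ext ?_ ?_
    · apply Subtype.ext
      apply Units.ext
      show (g.1.val.val : Matrix (Fin 2) (Fin 2) (UnitaryGroup.LocalRing L v)) * εH.1.val.val = εH.1.val.val * g.1.val.val
      rw [h1, Matrix.mul_smul, Matrix.smul_mul, Matrix.mul_one, Matrix.one_mul]
    · apply Subtype.ext
      apply Units.ext
      show (g.2.val.val : Matrix (Fin 1) (Fin 1) (UnitaryGroup.LocalRing L v)) * εH.2.val.val = εH.2.val.val * g.2.val.val
      rw [h2', Matrix.mul_smul, Matrix.smul_mul, Matrix.mul_one, Matrix.one_mul]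
  -- class functions / central invariance of the predicates
  have hPH : ∀ g x : ((UnitaryGroup.cmDatum L 2 (Matrix.of fun i j : Fin 2 => if i.val + j.val + 1 = 2 then (1 : L) else 0)).Local v × (UnitaryGroup.cmDatum L 1 (Matrix.of fun i j : Fin 1 => if i.val + j.val + 1 = 1 then (1 : L) else 0)).Local v),
      IsLocalGRegular L v g → IsLocalGRegular L v (x * g * x⁻¹) := fun g x hg =>
    isGRegular_of_isStablyConjH _ _ _ _ (isStablyConjH_of_isConj (isConj_iff.2 ⟨x, rfl⟩)) hg
  have hPG : ∀ g x : (UnitaryGroup.cmDatum L 3 H').Local v, IsRegularElt (g.val : GL (Fin 3) (UnitaryGroup.LocalRing L v)) →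
      IsRegularElt ((x * g * x⁻¹).val : GL (Fin 3) (UnitaryGroup.LocalRing L v)) := fun g x hg => by
    show IsRegularElt (x.val * g.val * x.val⁻¹)
    exact (isRegularElt_conj_iff _ _).2 hg
  have hst_conj := isLocalStablyConjH_conj_right_iff L v
  have hst_z := isLocalStablyConjH_central_mul_iff L v εH a h1 h2'
  have hP_st : ∀ a' b' : ((UnitaryGroup.cmDatum L 2 (Matrix.of fun i j : Fin 2 => if i.val + j.val + 1 = 2 then (1 : L) else 0)).Local v × (UnitaryGroup.cmDatum L 1 (Matrix.of fun i j : Fin 1 => if i.val + j.val + 1 = 1 then (1 : L) else 0)).Local v),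
      IsLocalGRegular L v a' → IsLocalStablyConjH L v a' b' → IsLocalGRegular L v b' := fun a' b' ha' hst => isGRegular_of_isStablyConjH _ _ _ _ hst ha'
  have hP_z : ∀ a' : ((UnitaryGroup.cmDatum L 2 (Matrix.of fun i j : Fin 2 => if i.val + j.val + 1 = 2 then (1 : L) else 0)).Local v × (UnitaryGroup.cmDatum L 1 (Matrix.of fun i j : Fin 1 => if i.val + j.val + 1 = 1 then (1 : L) else 0)).Local v),
      IsLocalGRegular L v a' → IsLocalGRegular L v (εH * a') := fun a' ha' => (isLocalGRegular_central_mul_iff L v εH a ha h1 h2' a').2 ha'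
  -- the identity statement applied to `φ′ := φ(z·)`
  have hφ' : IsLocSmooth (fun x : (UnitaryGroup.cmDatum L 3 H').Local v => φ (z * x)) :=
    ⟨hφ.1.comp_continuous (continuous_const_mul z), hφ.2.comp_homeomorph (Homeomorph.mulLeft z)⟩
  obtain ⟨V', hV', φH', hφH', hid⟩ := hId L H' μ νH νG hμu hμω hH hHan v hv mH mG hcanH hcanG (fun x => φ (z * x)) hφ'
  refine ⟨(fun y => εH⁻¹ * y) ⁻¹' V', ?_, fun y => finHeckeValue L v μ a * φH' (εH⁻¹ * y), ?_, ?_⟩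
  · -- `εH·V′ ∈ 𝓝 εH`
    refine (continuous_const_mul εH⁻¹).continuousAt.preimage_mem_nhds ?_
    show V' ∈ 𝓝 (εH⁻¹ * εH)
    rw [inv_mul_cancel]
    exact hV'
  · -- `φH` is test
    have hfun : (fun y => finHeckeValue L v μ a * φH' (εH⁻¹ * y)) =
        ((fun _ => finHeckeValue L v μ a) * (φH' ∘ ⇑(Homeomorph.mulLeft εH⁻¹))) := by
      funext y; simp only [Pi.mul_apply, Function.comp_apply, Homeomorph.coe_mulLeft]
    rw [hfun]
    exact ⟨(IsLocallyConstant.const (finHeckeValue L v μ a)).mul (hφH'.1.comp_continuous (Homeomorph.mulLeft εH⁻¹).continuous),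
      (hφH'.2.comp_homeomorph (Homeomorph.mulLeft εH⁻¹)).mul_left⟩
  · -- the identity at `γH = εH γ′ ∈ εH·V′`, `G`-regular
    intro γH hγV hγreg
    obtain ⟨γ', rfl⟩ : ∃ γ', γH = εH * γ' := ⟨εH⁻¹ * γH, (mul_inv_cancel_left εH γH).symm⟩
    have hγ'V : γ' ∈ V' := by simpa only [Set.mem_preimage, inv_mul_cancel_left] using hγV
    have hreg' : IsLocalGRegular L v γ' := (isLocalGRegular_central_mul_iff L v εH a ha h1 h2' γ').1 hγreg
    have key := hid γ' hγ'V hreg'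
    -- LHS: central translation on `H_v`, then linearity
    rw [hcanH.stableOrbitalIntegralRel_central_mul_eq hPH hεc (IsLocalStablyConjH L v) hst_conj hst_z hP_st hP_z hreg' _]
    have hφeq : (fun x => finHeckeValue L v μ a * φH' (εH⁻¹ * (εH * x))) = fun x => finHeckeValue L v μ a * φH' x := by
      funext x; rw [inv_mul_cancel_left]
    rw [hφeq, stableOrbitalIntegralRel_const_mul, key, mul_finsum]
    -- RHS: re-index the classes of `G′_v` along `c ↦ ⟦z · out c⟧`
    refine finsum_eq_of_bijective (fun c : ConjClasses ((UnitaryGroup.cmDatum L 3 H').Local v) => ConjClasses.mk (z * Quotient.out c))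
      (bijective_conjClassesMk_central_mul_out hzc) fun c => ?_
    -- the term at `c`: factor side (central-character rule) and orbital side (central translation), or `Δ‴ = 0` off the norm pairs
    obtain ⟨y, hy⟩ := isConj_iff.1 (isConj_out_conjClassesMk (z * Quotient.out c))
    have hΔ : ((finExplicitCollection L H' μ (finExplicitDelta_conj_left_all L H' μ) (finExplicitDelta_conj_right_all L H' μ)) v).Δ (εH * γ') (Quotient.out (ConjClasses.mk (z * Quotient.out c))) =
        finHeckeValue L v μ a * ((finExplicitCollection L H' μ (finExplicitDelta_conj_left_all L H' μ) (finExplicitDelta_conj_right_all L H' μ)) v).Δ γ' (Quotient.out c) := by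
      rw [finExplicitCollection_Δ_eq, finExplicitCollection_Δ_eq,
        ← finExplicitDelta_conj_right L v H' μ (εH * γ') (Quotient.out (ConjClasses.mk (z * Quotient.out c))) y, hy,
        finExplicitDelta_central_mul L v H' εH γ' z (Quotient.out c) a h1 h2' hz μ]
    by_cases hnp : IsLocalNormPair L H' v γ' (Quotient.out c)
    · have hregc : IsRegularElt ((Quotient.out c).val : GL (Fin 3) (UnitaryGroup.LocalRing L v)) := isRegularElt_of_isLocalNormPair (L := L) (v := v) (H' := H') hnp hreg'
      have hnp' : IsLocalNormPair L H' v (εH * γ') (z * Quotient.out c) := (isLocalNormPair_central_mul L v H' εH γ' z (Quotient.out c) a h1 h2' hz).2 hnp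
      have hregzc : IsRegularElt ((z * Quotient.out c).val : GL (Fin 3) (UnitaryGroup.LocalRing L v)) := isRegularElt_of_isLocalNormPair (L := L) (v := v) (H' := H') hnp' hγreg
      rw [hΔ, hcanG.classOrbitalIntegral_mk_central_mul_eq hPG hzc hregc hregzc φ, conjClassesMk_out_eq, mul_assoc]
    · have h0 : ((finExplicitCollection L H' μ (finExplicitDelta_conj_left_all L H' μ) (finExplicitDelta_conj_right_all L H' μ)) v).Δ γ' (Quotient.out c) = 0 := by
        rw [finExplicitCollection_Δ_eq]; exact finExplicitDelta_of_not_isLocalNormPair L v H' _ μ hnp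
      rw [hΔ, h0, mul_zero, zero_mul, zero_mul, mul_zero]

end Reduction

end Summit.HodgeConjecture.HodgeConjecture.Cruxes.H413.F0P3aN6nsS3OfIdentity

end
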